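import Summits.CriticalPhenomena.PercolationContinuityZ3.Theorems.PercNearOneGluingNoHeavyLowerTailSahiTwoLevelTopAbsorbing
import HarnessLib

/-!
# The two-level TOP law reduces to TOP-ANTICHAIN nested pairs (typed restriction and the equivalence)

Companion of `…SahiTwoLevelTopAbsorbing` (crux `NoHeavyLowerTail`, stmt-CriticalPhenomena-4575; master-family line P2, seat
`prim-masterthm-p2` gen 21; memo `run/shared/lean/prim/prim-masterthm/FROM-prim-masterthm-p2-g21-TOP-ABSORBING.md`).
ONE `@[conjecture]` definition (`TopAntichainPlus`, an obligation of THIS programme — the RESTRICTION of the open law `SahiTwoLevelPlus`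
to the complement of the (proved) top-absorbing face; census-clean, NOT a published fact); no sorry; axioms standard.

* `TopAntichainPlus` — `T⁺(G,H) ≥ 0` for nested pairs of triples of increasing events whose TOP triple is 3-wise non-absorbing
  (`G_j ∩ G_k ⊄ G_i` for all `i`).
* `sahiTwoLevelPlus_iff_topAntichainPlus` — EQUIVALENT to `SahiTwoLevelPlus` (the top-absorbing face is the theorem
  `SahiTwoLevelVariational.twoLevelPlus_nonneg_of_topAbsorbing`); hence `kahnConjecture_of_topAntichainPlus`,
  `masterFamilyNonneg_three_of_topAntichainPlus`.
So every future argument for the two-level top law (the variational route, lane P1's co-sunflower line, bnk-2's PLUS′) may assume that no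
top contains the meet of the other two; on `{0,1}^3` the only such tops outside the older proved faces are the co-sunflower tops
`(x₀∨x₁, x₀∨x₂, x₁∨x₂)` (census in the companion file's docstring).
HONEST LABEL: a typed restriction of an OPEN law and an elementary equivalence; nothing here asserts `TopAntichainPlus`,
`SahiTwoLevelPlus` or Kahn's Conjecture 5 (all OPEN). [this work]
-/

noncomputable section

open scoped Classical

namespace Summit.CriticalPhenomena.PercolationContinuityZ3.Theorems

namespace SahiTwoLevelVariational

open Finset Function MeasureTheory
open Literature.Combinatorics.Sahi2008
open Literature.Probability.LatticeModels (prodBernoulli)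

/-- **CONJECTURE (the two-level TOP law on TOP-ANTICHAIN pairs)**, an obligation of THIS programme (NOT a published fact): `T⁺(G,H) ≥ 0`
for every nested pair of triples of increasing events of a finite cube under a product measure whose TOP triple is 3-wise non-absorbing
(`G_j ∩ G_k ⊄ G_i` for all `i`).  It is the RESTRICTION of `SahiTwoLevelPlus` to the complement of the top-absorbing face and is
EQUIVALENT to it (`sahiTwoLevelPlus_iff_topAntichainPlus`); census: as `SahiTwoLevelPlus` (exhaustive on `≤ 5` coordinates at grid biases,
lanes bnk-2 / P2 / ttrl; descent adversary on `≤ 7`).  Implies Kahn's Conjecture 5 (`kahnConjecture_of_topAntichainPlus`).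
[cite: Kahn2022, Conj. 5 (arXiv p. 3)] [status: open] -/
@[conjecture] def TopAntichainPlus : Prop :=
  ∀ (κ : Type) [Fintype κ] (q : κ → unitInterval) (G H : Fin 3 → Set (Set κ)),
    (∀ i, IsUpperSet (G i)) → (∀ i, IsUpperSet (H i)) → (∀ i, H i ⊆ G i) →
    ¬ (G 1 ∩ G 2 ⊆ G 0) → ¬ (G 2 ∩ G 0 ⊆ G 1) → ¬ (G 0 ∩ G 1 ⊆ G 2) →
      0 ≤ twoLevelForm (fun A => (prodBernoulli q).real A) G H
            - ∏ i, ((prodBernoulli q).real (G i) - (prodBernoulli q).real (H i))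

/-- **THE REDUCTION**: the top law on top-antichain pairs gives the top law everywhere (the top-absorbing face is proved). [this work] -/
theorem sahiTwoLevelPlus_of_topAntichainPlus (h : TopAntichainPlus) : SahiTwoLevelPlus := by
  intro κ _ q G H hG hH hHG
  by_cases h0 : G 1 ∩ G 2 ⊆ G 0
  · exact twoLevelPlus_nonneg_of_topAbsorbing q G H hG hH hHG (Or.inl h0)
  by_cases h1 : G 2 ∩ G 0 ⊆ G 1
  · exact twoLevelPlus_nonneg_of_topAbsorbing q G H hG hH hHG (Or.inr (Or.inl h1))
  by_cases h2 : G 0 ∩ G 1 ⊆ G 2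
  · exact twoLevelPlus_nonneg_of_topAbsorbing q G H hG hH hHG (Or.inr (Or.inr h2))
  exact h κ q G H hG hH hHG h0 h1 h2

/-- The converse is a restriction. [this work] -/
theorem topAntichainPlus_of_sahiTwoLevelPlus (h : SahiTwoLevelPlus) : TopAntichainPlus :=
  fun κ _ q G H hG hH hHG _ _ _ => h κ q G H hG hH hHG

/-- **`SahiTwoLevelPlus ↔ TopAntichainPlus`.** [this work] -/
theorem sahiTwoLevelPlus_iff_topAntichainPlus : SahiTwoLevelPlus ↔ TopAntichainPlus :=
  ⟨topAntichainPlus_of_sahiTwoLevelPlus, sahiTwoLevelPlus_of_topAntichainPlus⟩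

/-- **TOP-ANTICHAIN TOP LAW ⟹ KAHN'S CONJECTURE 5.** [this work] -/
theorem kahnConjecture_of_topAntichainPlus (h : TopAntichainPlus) : KahnConjecture :=
  kahnConjecture_of_sahiTwoLevelPlus (sahiTwoLevelPlus_of_topAntichainPlus h)

/-- **TOP-ANTICHAIN TOP LAW ⟹ `MasterFamilyNonneg 3`** (Sahi's `C_3` on product measures). [this work] -/
theorem masterFamilyNonneg_three_of_topAntichainPlus (h : TopAntichainPlus) : MasterFamilyNonneg 3 :=
  masterFamilyNonneg_three_of_sahiTwoLevelPlus (sahiTwoLevelPlus_of_topAntichainPlus h)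

end SahiTwoLevelVariational

end Summit.CriticalPhenomena.PercolationContinuityZ3.Theorems
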